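import Mathlib
import HarnessLib
import Summits.Ventures.LatticeQCDFlow.Scoring.SplitChainWeightedTourMoments
import Summits.Ventures.LatticeQCDFlow.Scoring.SplitChainCoinCount
import Summits.Ventures.LatticeQCDFlow.Scoring.SplitChainCycleFormula
import Summits.Ventures.LatticeQCDFlow.Scoring.RegenerativeTourCovarianceSq
import Summits.Ventures.LatticeQCDFlow.Scoring.SplitChainFreshPairMoments

/-!
# The Anscombe step by second moments: replacing the random number `K_m` of started tours by a
# deterministic number `a` costs `E[(Σ_{i ≤ K_m} Z_i − Σ_{i ≤ a} Z_i)²] = v · E|K_m − a|`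

HONEST FRAMING: exact (Metropolis-corrected) sampling algorithms for lattice gauge theory;
figures of merit are autocorrelation/cost numbers at stated couplings and volumes; no
continuum-physics claim.

Venture `LatticeQCDFlow` (cell pub-lqcd), topic `Scoring`; FANOUT row 8 (`s0-cpn-nemc`, GEN-18).
NEW WORK of the cell; no definition is introduced.  Notation of `Scoring/SplitChainTours.lean`: split chain `P̂` of `κ(x, ·) ≥ ε ν` from ANY initial law, `π`
invariant, `|f| ≤ C`, `c = π(f)`, `Z_i = S^{f − c}_i`, head count `K_m`, `v = E_ν̂[Z_0²] = σ²_f/e`.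
For `m < N`, `a ≤ N` put `w_i = 1{i ≤ K_m} − 1{i ≤ a}` (`i ≥ 1`) and
`D = Σ_{1 ≤ i ≤ N} w_i Z_i = Σ_{i ≤ K_m} Z_i − Σ_{i ≤ a} Z_i` (tours `≥ 1`).  As `1{i ≤ K_m} = 1{τ_i ≤ m}`
is read off AT the regeneration time `τ_i`, `Scoring/SplitChainWeightedTourMoments.lean` gives:
cross terms vanish (`E_ν̂[Z_0] = 0`), `E[w_i² Z_i²] = E[w_i²] · v`; so **`E[D²] = v · E|K_m − a|`**, hence
`E[D²] ≤ v (√m + |e m − a|)` (`Scoring/SplitChainCoinCount.lean`) — the Anscombe step by second moments.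
Printed counterpart NAMED ONLY: Anscombe 1952; Wald's identities — nothing is cited as a fact.

Content: `sum_sq_indicator_sub_indicator`, `started_iff_of_tourStart` (bookkeeping);
**`splitChain_anscombe_sq_eq`** (`D²` integrable, `E[D²] = v · E|K_m − a|`);
**`splitChain_anscombe_sq_le`**.  NOT CLAIMED: higher moments.
-/

noncomputable section

namespace Summit.Ventures.LatticeQCDFlow.Scoring

open MeasureTheory ProbabilityTheory Filter Finset Preorder Literature.Probability.MarkovChains
open scoped ENNReal

/-! ### Combinatorics of the weights -/

section Combinatorics

/-- `Σ_{i<N} 1{i + 1 ≤ K} = min K N`. -/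
theorem sum_indicator_succ_le_eq_min (K : ℕ) : ∀ N : ℕ,
    ∑ i ∈ Finset.range N, (if i + 1 ≤ K then (1 : ℝ) else 0) = ((min K N : ℕ) : ℝ)
  | 0 => by simp
  | N + 1 => by
    rw [Finset.sum_range_succ, sum_indicator_succ_le_eq_min K N]
    by_cases h : N + 1 ≤ K
    · rw [if_pos h, Nat.min_eq_right (by omega : N ≤ K), Nat.min_eq_right h]; push_cast; ring
    · rw [if_neg h, add_zero, Nat.min_eq_left (by omega : K ≤ N), Nat.min_eq_left (by omega : K ≤ N + 1)]

/-- **`Σ_{i<N} (1{i+1 ≤ K} − 1{i+1 ≤ a})² = |K − a|`** for `K, a ≤ N`. -/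
theorem sum_sq_indicator_sub_indicator {K a N : ℕ} (hK : K ≤ N) (ha : a ≤ N) :
    ∑ i ∈ Finset.range N, ((if i + 1 ≤ K then (1 : ℝ) else 0) - (if i + 1 ≤ a then (1 : ℝ) else 0)) ^ 2
      = |((K : ℝ) - a)| := by
  have hexp : ∀ i : ℕ, ((if i + 1 ≤ K then (1 : ℝ) else 0) - (if i + 1 ≤ a then (1 : ℝ) else 0)) ^ 2
      = (if i + 1 ≤ K then (1 : ℝ) else 0) + (if i + 1 ≤ a then (1 : ℝ) else 0)
        - 2 * (if i + 1 ≤ min K a then (1 : ℝ) else 0) := by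
    intro i
    by_cases h1 : i + 1 ≤ K
    · by_cases h2 : i + 1 ≤ a
      · rw [if_pos h1, if_pos h2, if_pos (le_min h1 h2)]; norm_num
      · rw [if_pos h1, if_neg h2, if_neg (fun h => h2 (le_min_iff.1 h).2)]; norm_num
    · by_cases h2 : i + 1 ≤ a
      · rw [if_neg h1, if_pos h2, if_neg (fun h => h1 (le_min_iff.1 h).1)]; norm_num
      · rw [if_neg h1, if_neg h2, if_neg (fun h => h1 (le_min_iff.1 h).1)]; norm_num
  simp_rw [hexp]
  rw [Finset.sum_sub_distrib, Finset.sum_add_distrib, ← Finset.mul_sum,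
    sum_indicator_succ_le_eq_min, sum_indicator_succ_le_eq_min, sum_indicator_succ_le_eq_min,
    Nat.min_eq_left hK, Nat.min_eq_left ha, Nat.min_eq_left ((min_le_left K a).trans hK)]
  rcases le_total K a with h | h
  · rw [Nat.min_eq_left h, abs_of_nonpos (sub_nonpos.2 (by exact_mod_cast h))]
    ring
  · rw [Nat.min_eq_right h, abs_of_nonneg (sub_nonneg.2 (by exact_mod_cast h))]
    ring

end Combinatorics

/-! ### The weights are read off at the regeneration times -/

section Anscombe

variable {Ω : Type*} [MeasurableSpace Ω]
  {κ : Kernel Ω Ω} [IsMarkovKernel κ] {ν : Measure Ω} [IsProbabilityMeasure ν] {ε : ℝ≥0∞}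
  {hmin : ∀ x {B : Set Ω}, MeasurableSet B → ε * ν B ≤ κ x B}
  (κs : Kernel (Ω × Bool) (Ω × Bool)) [IsMarkovKernel κs]
  (μs : Measure (Ω × Bool)) [IsProbabilityMeasure μs]

omit [MeasurableSpace Ω] in
/-- Pathwise: if tour `i + 1` starts at `t₀ + 1` (`K_{t₀} = i`, `coin_{t₀+1}`), then
`i + 1 ≤ K_m ↔ t₀ + 1 ≤ m`, and also `i + 1 ≤ K_{min m t} ↔ i + 1 ≤ K_m` whenever `t₀ < t`. -/
theorem started_iff_of_tourStart (x : ℕ → Ω × Bool) {i t₀ : ℕ}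
    (ht₀ : (∑ s ∈ Finset.range t₀, (if (x (s + 1)).2 then (1 : ℕ) else 0)) = i) (hh₀ : (x (t₀ + 1)).2 = true) (m : ℕ) :
    (i + 1 ≤ (∑ s ∈ Finset.range m, (if (x (s + 1)).2 then (1 : ℕ) else 0)) ↔ t₀ + 1 ≤ m)
    ∧ ∀ t, t₀ + 1 ≤ t → (i + 1 ≤ (∑ s ∈ Finset.range (min m t), (if (x (s + 1)).2 then (1 : ℕ) else 0)) ↔ i + 1 ≤ (∑ s ∈ Finset.range m, (if (x (s + 1)).2 then (1 : ℕ) else 0))) := by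
  have hsucc : (∑ s ∈ Finset.range (t₀ + 1), (if (x (s + 1)).2 then (1 : ℕ) else 0)) = i + 1 := by rw [headCount_succ, ht₀, hh₀]; rfl
  have key : ∀ m : ℕ, i + 1 ≤ (∑ s ∈ Finset.range m, (if (x (s + 1)).2 then (1 : ℕ) else 0)) ↔ t₀ + 1 ≤ m := by
    intro m
    constructor
    · intro h
      by_contra hlt
      have h2 := headCount_mono x (show m ≤ t₀ by omega)
      rw [ht₀] at h2
      omega
    · intro h
      have h2 := headCount_mono x h
      rw [hsucc] at h2
      exact h2
  refine ⟨key m, fun t ht => ?_⟩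
  rw [key, key]
  constructor
  · intro h; exact (le_min_iff.1 h).1
  · intro h; exact le_min h (by omega)

/-- **`E[D²] = v · E|K_m − a|`**: `π` invariant, `0 < ε < 1`, `|f| ≤ C` measurable, any initial law,
`m < N`, `a ≤ N`; `D = Σ_{i<N} w_{i+1} Z_{i+1}` with `w_{i+1} = 1{i+1 ≤ K_m} − 1{i+1 ≤ a}`. -/
theorem splitChain_anscombe_sq_eq {π : Measure Ω} [IsProbabilityMeasure π]
    (hπ : Kernel.Invariant κ π) (hε0 : 0 < ε) (hε : ε < 1)
    (hκs : ∀ p, κs p = (ε • ν).map (fun y : Ω => (y, true))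
      + ((1 - ε) • Doeblin.residualKernel κ ν ε hmin p.1).map (fun y : Ω => (y, false)))
    {f : Ω → ℝ} (hf : Measurable f) {C : ℝ} (hC : ∀ x, |f x| ≤ C)
    {m a N : ℕ} (hmN : m < N) (haN : a ≤ N) :
    Integrable (fun x : ℕ → Ω × Bool => (∑ i ∈ Finset.range N, ((if i + 1 ≤ (∑ s ∈ Finset.range m, (if (x (s + 1)).2 then (1 : ℕ) else 0)) then (1 : ℝ) else 0) - (if i + 1 ≤ a then (1 : ℝ) else 0)) * (∑' u, (if (∑ s ∈ Finset.range u, (if (x (s + 1)).2 then (1 : ℕ) else 0)) = i + 1 then (1 : ℝ) else 0) * (f (x u).1 - ∫ z, f z ∂π))) ^ 2) (Kernel.trajMeasure (X := fun _ : ℕ => Ω × Bool) μs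
        (fun n : ℕ => κs.comap (fun h : (i : ↥(Finset.Iic n)) → Ω × Bool =>
          h ⟨n, Finset.mem_Iic.2 le_rfl⟩) (measurable_pi_apply _)))
    ∧ ∫ x, (∑ i ∈ Finset.range N, ((if i + 1 ≤ (∑ s ∈ Finset.range m, (if (x (s + 1)).2 then (1 : ℕ) else 0)) then (1 : ℝ) else 0) - (if i + 1 ≤ a then (1 : ℝ) else 0)) * (∑' u, (if (∑ s ∈ Finset.range u, (if (x (s + 1)).2 then (1 : ℕ) else 0)) = i + 1 then (1 : ℝ) else 0) * (f (x u).1 - ∫ z, f z ∂π))) ^ 2 ∂(Kernel.trajMeasure (X := fun _ : ℕ => Ω × Bool) μs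
        (fun n : ℕ => κs.comap (fun h : (i : ↥(Finset.Iic n)) → Ω × Bool =>
          h ⟨n, Finset.mem_Iic.2 le_rfl⟩) (measurable_pi_apply _)))
      = (∫ y, (∑' u, (if (∑ s ∈ Finset.range u, (if (y (s + 1)).2 then (1 : ℕ) else 0)) = 0 then (1 : ℝ) else 0) * (f (y u).1 - ∫ z, f z ∂π)) ^ 2 ∂(Kernel.trajMeasure (X := fun _ : ℕ => Ω × Bool) (ν.map (fun y : Ω => (y, true)))
        (fun n : ℕ => κs.comap (fun h : (i : ↥(Finset.Iic n)) → Ω × Bool =>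
          h ⟨n, Finset.mem_Iic.2 le_rfl⟩) (measurable_pi_apply _))))
        * ∫ x, |(((∑ s ∈ Finset.range m, (if (x (s + 1)).2 then (1 : ℕ) else 0)) : ℕ) : ℝ) - a| ∂(Kernel.trajMeasure (X := fun _ : ℕ => Ω × Bool) μs
        (fun n : ℕ => κs.comap (fun h : (i : ↥(Finset.Iic n)) → Ω × Bool =>
          h ⟨n, Finset.mem_Iic.2 le_rfl⟩) (measurable_pi_apply _))) := by
  haveI hνt : IsProbabilityMeasure (ν.map (fun y : Ω => (y, true))) :=
    Measure.isProbabilityMeasure_map (measurable_tagCoin true).aemeasurable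
  set P := (Kernel.trajMeasure (X := fun _ : ℕ => Ω × Bool) μs
        (fun n : ℕ => κs.comap (fun h : (i : ↥(Finset.Iic n)) → Ω × Bool =>
          h ⟨n, Finset.mem_Iic.2 le_rfl⟩) (measurable_pi_apply _))) with hP
  set Pν := (Kernel.trajMeasure (X := fun _ : ℕ => Ω × Bool) (ν.map (fun y : Ω => (y, true)))
        (fun n : ℕ => κs.comap (fun h : (i : ↥(Finset.Iic n)) → Ω × Bool =>
          h ⟨n, Finset.mem_Iic.2 le_rfl⟩) (measurable_pi_apply _))) with hPν
  set c := ∫ z, f z ∂π with hc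
  set v := ∫ y, (∑' u, (if (∑ s ∈ Finset.range u, (if (y (s + 1)).2 then (1 : ℕ) else 0)) = 0 then (1 : ℝ) else 0) * (f (y u).1 - c)) ^ 2 ∂Pν with hv
  obtain ⟨hg, hCg, -⟩ := centred_observable_bounds π hf hC
  -- tour sums, weights, measurability
  set Zt : ℕ → (ℕ → Ω × Bool) → ℝ := fun i x => (∑' u, (if (∑ s ∈ Finset.range u, (if (x (s + 1)).2 then (1 : ℕ) else 0)) = i then (1 : ℝ) else 0) * (f (x u).1 - c)) with hZt
  set wt : ℕ → (ℕ → Ω × Bool) → ℝ := fun i x => ((if i ≤ (∑ s ∈ Finset.range m, (if (x (s + 1)).2 then (1 : ℕ) else 0)) then (1 : ℝ) else 0) - (if i ≤ a then (1 : ℝ) else 0)) with hwt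
  have hZm : ∀ i, Measurable (Zt i) := fun i =>
    measurable_tourSum (Ω := Ω) (ψ := fun p _ => f p.1 - c) (hg.comp (measurable_fst.comp measurable_fst)) i
  have hwm : ∀ i, Measurable (wt i) := fun i =>
    (Measurable.ite (measurableSet_le measurable_const (measurable_headCount m)) measurable_const
      measurable_const).sub measurable_const
  have hwC : ∀ i x, |wt i x| ≤ 1 := fun i x => by
    simp only [hwt]; split_ifs <;> norm_num
  -- the regeneration-time weights realising `wt (i+1)` (and a past-measurable copy for an earlier tour)
  have hae := splitChain_ae_tourStart κs μs (κ := κ) (ν := ν) (hmin := hmin) hε0 hε hκs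
  rw [← hP] at hae
  -- E_ν̂[Z_0] = 0 and integrability of `Z_0²`
  have hZ0 := (splitChain_fresh_integral_centredTourSum κs (κ := κ) (ν := ν) (hmin := hmin) hπ hε0 hε
    hκs hf hC).2
  rw [← hPν] at hZ0
  have hZ0sq : Integrable (fun y => (∑' u, (if (∑ s ∈ Finset.range u, (if (y (s + 1)).2 then (1 : ℕ) else 0)) = 0 then (1 : ℝ) else 0) * (f (y u).1 - c)) ^ 2) Pν := by
    have h := splitChain_integrable_sq_tourSum κs (ν.map (fun y : Ω => (y, true))) (κ := κ) (ν := ν)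
      (hmin := hmin) hε0 hε hκs hg hCg 0
    rw [← hPν] at h
    exact h
  -- (1) off-diagonal terms vanish: `i < i'`
  have hoff : ∀ i i' : ℕ, i < i' →
      Integrable (fun x => wt (i + 1) x * Zt (i + 1) x * (wt (i' + 1) x * Zt (i' + 1) x)) P
      ∧ ∫ x, wt (i + 1) x * Zt (i + 1) x * (wt (i' + 1) x * Zt (i' + 1) x) ∂P = 0 := by
    intro i i' hii'
    -- combined weight at `τ_{i'+1}`: `(1{i+1 ≤ K_{min m t}} − 1{i+1 ≤ a}) · (1{t+1 ≤ m} − 1{i'+1 ≤ a})`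
    set W : ℕ → (ℕ → Ω × Bool) → ℝ := fun t x =>
      ((if i + 1 ≤ (∑ s ∈ Finset.range (min m t), (if (x (s + 1)).2 then (1 : ℕ) else 0)) then (1 : ℝ) else 0) - (if i + 1 ≤ a then (1 : ℝ) else 0))
        * ((if t + 1 ≤ m then (1 : ℝ) else 0) - (if i' + 1 ≤ a then (1 : ℝ) else 0)) with hW
    have hWm : ∀ t, Measurable (W t) := fun t =>
      ((Measurable.ite (measurableSet_le measurable_const (measurable_headCount (min m t)))
        measurable_const measurable_const).sub measurable_const).mul measurable_const
    have hWd : ∀ t, DependsOn (W t) (Set.Iic t) := by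
      intro t x y hxy
      simp only [hW]
      have hK : (∑ s ∈ Finset.range (min m t), (if (x (s + 1)).2 then (1 : ℕ) else 0)) = (∑ s ∈ Finset.range (min m t), (if (y (s + 1)).2 then (1 : ℕ) else 0)) :=
        Finset.sum_congr rfl fun s hs => by
          rw [hxy (s + 1) (Set.mem_Iic.2 (by have := Finset.mem_range.1 hs; omega))]
      rw [hK]
    have hWC : ∀ t x, |W t x| ≤ 1 := fun t x => by
      simp only [hW]; rw [abs_mul]
      refine mul_le_one₀ ?_ (abs_nonneg _) ?_ <;> split_ifs <;> norm_num
    have hcm := splitChain_tour_crossMoment_weighted κs μs (κ := κ) (ν := ν) (hmin := hmin) hε0 hε hκs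
      hWm hWd hWC hg hg hCg hCg (i := i + 1) (j := i') (by omega)
    rw [← hP, ← hPν] at hcm
    -- a.s. the weighted integrand is ours
    have hid : ∀ᵐ x ∂P, (∑' u, (if (∑ s ∈ Finset.range u, (if (x (s + 1)).2 then (1 : ℕ) else 0)) = i + 1 then (1 : ℝ) else 0) * (f (x u).1 - c))
        * (∑' t, (if (∑ s ∈ Finset.range t, (if (x (s + 1)).2 then (1 : ℕ) else 0)) = i' then (1 : ℝ) else 0) * (if (x (t + 1)).2 then (1 : ℝ) else 0) * W t x) * (∑' u, (if (∑ s ∈ Finset.range u, (if (x (s + 1)).2 then (1 : ℕ) else 0)) = i' + 1 then (1 : ℝ) else 0) * (f (x u).1 - c))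
        = wt (i + 1) x * Zt (i + 1) x * (wt (i' + 1) x * Zt (i' + 1) x) := by
      filter_upwards [hae] with x hx
      obtain ⟨t₀, ht₀, hh₀⟩ := hx i
      obtain ⟨t₁, ht₁, hh₁⟩ := hx i'
      have hzero : ∀ t, t ≠ t₁ → (if (∑ s ∈ Finset.range t, (if (x (s + 1)).2 then (1 : ℕ) else 0)) = i' then (1 : ℝ) else 0) * (if (x (t + 1)).2 then (1 : ℝ) else 0) * W t x = 0 := fun t hne => by
        by_cases h1 : (∑ s ∈ Finset.range t, (if (x (s + 1)).2 then (1 : ℕ) else 0)) = i'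
        · have h2 : ¬ (x (t + 1)).2 = true := fun h2 => hne (tourStart_unique x h1 h2 ht₁ hh₁)
          rw [if_neg h2, mul_zero, zero_mul]
        · rw [if_neg h1, zero_mul, zero_mul]
      have ht01 : t₀ + 1 ≤ t₁ := by
        by_contra hlt
        have := headCount_mono x (show t₁ ≤ t₀ by omega)
        rw [ht₀, ht₁] at this
        omega
      obtain ⟨hi0, hi0'⟩ := started_iff_of_tourStart x ht₀ hh₀ m
      obtain ⟨hi1, -⟩ := started_iff_of_tourStart x ht₁ hh₁ m
      have hWval : W t₁ x = wt (i + 1) x * wt (i' + 1) x := by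
        simp only [hW, hwt]
        congr 1
        · by_cases h : i + 1 ≤ (∑ s ∈ Finset.range m, (if (x (s + 1)).2 then (1 : ℕ) else 0))
          · rw [if_pos h, if_pos ((hi0' t₁ ht01).2 h)]
          · rw [if_neg h, if_neg (fun h' => h ((hi0' t₁ ht01).1 h'))]
        · by_cases h : t₁ + 1 ≤ m
          · rw [if_pos h, if_pos (hi1.2 h)]
          · rw [if_neg h, if_neg (fun h' => h (hi1.1 h'))]
      rw [tsum_eq_single t₁ hzero, if_pos ht₁, if_pos hh₁, one_mul, one_mul, hWval]
      simp only [hZt]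
      ring
    refine ⟨hcm.1.congr hid, ?_⟩
    rw [← integral_congr_ae hid, hcm.2, hZ0, mul_zero]
  -- (2) diagonal terms: `E[w² Z²] = E[w²] · v`
  have hdiag : ∀ i : ℕ,
      Integrable (fun x => wt (i + 1) x * Zt (i + 1) x * (wt (i + 1) x * Zt (i + 1) x)) P
      ∧ ∫ x, wt (i + 1) x * Zt (i + 1) x * (wt (i + 1) x * Zt (i + 1) x) ∂P
        = (∫ x, wt (i + 1) x ^ 2 ∂P) * v := by
    intro i
    set W : ℕ → (ℕ → Ω × Bool) → ℝ := fun t _ =>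
      ((if t + 1 ≤ m then (1 : ℝ) else 0) - (if i + 1 ≤ a then (1 : ℝ) else 0)) ^ 2 with hW
    have hWm : ∀ t, Measurable (W t) := fun t => measurable_const
    have hWd : ∀ t, DependsOn (W t) (Set.Iic t) := fun t x y _ => rfl
    have hWC : ∀ t x, |W t x| ≤ 1 := fun t x => by
      simp only [hW]; rw [abs_pow]; refine pow_le_one₀ (abs_nonneg _) ?_
      split_ifs <;> norm_num
    have hlaw := splitChain_tour_weighted_law κs μs (κ := κ) (ν := ν) (hmin := hmin) hε0 hε hκs hWm hWd
      hWC hg (Λ := fun r => r ^ 2) (measurable_id.pow_const 2) hZ0sq i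
    rw [← hP, ← hPν] at hlaw
    have hid : ∀ᵐ x ∂P, (∑' t, (if (∑ s ∈ Finset.range t, (if (x (s + 1)).2 then (1 : ℕ) else 0)) = i then (1 : ℝ) else 0) * (if (x (t + 1)).2 then (1 : ℝ) else 0) * W t x)
        * (∑' u, (if (∑ s ∈ Finset.range u, (if (x (s + 1)).2 then (1 : ℕ) else 0)) = i + 1 then (1 : ℝ) else 0) * (f (x u).1 - c)) ^ 2
        = wt (i + 1) x * Zt (i + 1) x * (wt (i + 1) x * Zt (i + 1) x) := by
      filter_upwards [hae] with x hx
      obtain ⟨t₀, ht₀, hh₀⟩ := hx i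
      have hzero : ∀ t, t ≠ t₀ → (if (∑ s ∈ Finset.range t, (if (x (s + 1)).2 then (1 : ℕ) else 0)) = i then (1 : ℝ) else 0) * (if (x (t + 1)).2 then (1 : ℝ) else 0) * W t x = 0 := fun t hne => by
        by_cases h1 : (∑ s ∈ Finset.range t, (if (x (s + 1)).2 then (1 : ℕ) else 0)) = i
        · have h2 : ¬ (x (t + 1)).2 = true := fun h2 => hne (tourStart_unique x h1 h2 ht₀ hh₀)
          rw [if_neg h2, mul_zero, zero_mul]
        · rw [if_neg h1, zero_mul, zero_mul]
      obtain ⟨hi0, -⟩ := started_iff_of_tourStart x ht₀ hh₀ m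
      have hWval : W t₀ x = wt (i + 1) x ^ 2 := by
        simp only [hW, hwt]
        congr 1
        by_cases h : t₀ + 1 ≤ m
        · rw [if_pos h, if_pos (hi0.2 h)]
        · rw [if_neg h, if_neg (fun h' => h (hi0.1 h'))]
      rw [tsum_eq_single t₀ hzero, if_pos ht₀, if_pos hh₀, one_mul, one_mul, hWval]
      simp only [hZt]
      ring
    have hid' : ∀ᵐ x ∂P, (∑' t, (if (∑ s ∈ Finset.range t, (if (x (s + 1)).2 then (1 : ℕ) else 0)) = i then (1 : ℝ) else 0) * (if (x (t + 1)).2 then (1 : ℝ) else 0) * W t x) = wt (i + 1) x ^ 2 := by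
      filter_upwards [hae] with x hx
      obtain ⟨t₀, ht₀, hh₀⟩ := hx i
      have hzero : ∀ t, t ≠ t₀ → (if (∑ s ∈ Finset.range t, (if (x (s + 1)).2 then (1 : ℕ) else 0)) = i then (1 : ℝ) else 0) * (if (x (t + 1)).2 then (1 : ℝ) else 0) * W t x = 0 := fun t hne => by
        by_cases h1 : (∑ s ∈ Finset.range t, (if (x (s + 1)).2 then (1 : ℕ) else 0)) = i
        · have h2 : ¬ (x (t + 1)).2 = true := fun h2 => hne (tourStart_unique x h1 h2 ht₀ hh₀)
          rw [if_neg h2, mul_zero, zero_mul]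
        · rw [if_neg h1, zero_mul, zero_mul]
      obtain ⟨hi0, -⟩ := started_iff_of_tourStart x ht₀ hh₀ m
      rw [tsum_eq_single t₀ hzero, if_pos ht₀, if_pos hh₀, one_mul, one_mul]
      simp only [hW, hwt]
      congr 1
      by_cases h : t₀ + 1 ≤ m
      · rw [if_pos h, if_pos (hi0.2 h)]
      · rw [if_neg h, if_neg (fun h' => h (hi0.1 h'))]
    -- integrability: bounded weight times the integrable `Z²`
    have hZsq : Integrable (fun x => Zt (i + 1) x ^ 2) P := by
      have h := splitChain_integrable_sq_tourSum κs μs (κ := κ) (ν := ν) (hmin := hmin) hε0 hε hκs hg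
        hCg (i + 1)
      rw [← hP] at h
      exact h
    have hint : Integrable (fun x => wt (i + 1) x * Zt (i + 1) x * (wt (i + 1) x * Zt (i + 1) x)) P := by
      refine (hZsq.bdd_mul (c := 1) ((hwm (i + 1)).pow_const 2).aestronglyMeasurable
        (ae_of_all _ fun x => ?_)).congr (ae_of_all _ fun x => ?_)
      · rw [Real.norm_eq_abs, abs_pow]; exact pow_le_one₀ (abs_nonneg _) (hwC _ x)
      · ring
    refine ⟨hint, ?_⟩
    rw [← integral_congr_ae hid, hlaw, integral_congr_ae hid']
  -- (3) expand the square and sum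
  have hprod : ∀ i ∈ Finset.range N, ∀ i' ∈ Finset.range N,
      Integrable (fun x => wt (i + 1) x * Zt (i + 1) x * (wt (i' + 1) x * Zt (i' + 1) x)) P
      ∧ ∫ x, wt (i + 1) x * Zt (i + 1) x * (wt (i' + 1) x * Zt (i' + 1) x) ∂P
        = if i = i' then (∫ x, wt (i + 1) x ^ 2 ∂P) * v else 0 := by
    intro i _ i' _
    rcases lt_trichotomy i i' with h | h | h
    · rw [if_neg h.ne]; exact hoff i i' h
    · subst h; rw [if_pos rfl]; exact hdiag i
    · rw [if_neg h.ne']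
      obtain ⟨hI, hE⟩ := hoff i' i h
      refine ⟨hI.congr (ae_of_all _ fun x => by ring), ?_⟩
      rw [← hE]
      exact integral_congr_ae (ae_of_all _ fun x => by ring)
  have hsq : ∀ x, (∑ i ∈ Finset.range N, ((if i + 1 ≤ (∑ s ∈ Finset.range m, (if (x (s + 1)).2 then (1 : ℕ) else 0)) then (1 : ℝ) else 0) - (if i + 1 ≤ a then (1 : ℝ) else 0)) * (∑' u, (if (∑ s ∈ Finset.range u, (if (x (s + 1)).2 then (1 : ℕ) else 0)) = i + 1 then (1 : ℝ) else 0) * (f (x u).1 - ∫ z, f z ∂π))) ^ 2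
      = ∑ i ∈ Finset.range N, ∑ i' ∈ Finset.range N,
          wt (i + 1) x * Zt (i + 1) x * (wt (i' + 1) x * Zt (i' + 1) x) := fun x => by
    rw [sq, Finset.sum_mul_sum]
  refine ⟨(integrable_finsetSum _ fun i hi => integrable_finsetSum _ fun i' hi' =>
    (hprod i hi i' hi').1).congr (ae_of_all _ fun x => ?_), ?_⟩
  · exact (hsq x).symm
  calc ∫ x, (∑ i ∈ Finset.range N, ((if i + 1 ≤ (∑ s ∈ Finset.range m, (if (x (s + 1)).2 then (1 : ℕ) else 0)) then (1 : ℝ) else 0) - (if i + 1 ≤ a then (1 : ℝ) else 0)) * (∑' u, (if (∑ s ∈ Finset.range u, (if (x (s + 1)).2 then (1 : ℕ) else 0)) = i + 1 then (1 : ℝ) else 0) * (f (x u).1 - ∫ z, f z ∂π))) ^ 2 ∂P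
      = ∫ x, ∑ i ∈ Finset.range N, ∑ i' ∈ Finset.range N,
          wt (i + 1) x * Zt (i + 1) x * (wt (i' + 1) x * Zt (i' + 1) x) ∂P :=
        integral_congr_ae (ae_of_all _ fun x => hsq x)
    _ = ∑ i ∈ Finset.range N, ∑ i' ∈ Finset.range N,
          ∫ x, wt (i + 1) x * Zt (i + 1) x * (wt (i' + 1) x * Zt (i' + 1) x) ∂P := by
        rw [integral_finsetSum _ fun i hi => integrable_finsetSum _ fun i' hi' => (hprod i hi i' hi').1]
        exact Finset.sum_congr rfl fun i hi => integral_finsetSum _ fun i' hi' => (hprod i hi i' hi').1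
    _ = ∑ i ∈ Finset.range N, (∫ x, wt (i + 1) x ^ 2 ∂P) * v := by
        refine Finset.sum_congr rfl fun i hi => ?_
        rw [Finset.sum_congr rfl fun i' hi' => (hprod i hi i' hi').2, Finset.sum_ite_eq, if_pos hi]
    _ = v * ∫ x, ∑ i ∈ Finset.range N, wt (i + 1) x ^ 2 ∂P := by
        rw [integral_finsetSum _ fun i _ => ?_, Finset.mul_sum]
        · exact Finset.sum_congr rfl fun i _ => mul_comm _ _
        · exact integrable_of_bounded P ((hwm (i + 1)).pow_const 2) (C := 1) fun x => by
            rw [abs_pow]; exact pow_le_one₀ (abs_nonneg _) (hwC _ x)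
    _ = v * ∫ x, |(((∑ s ∈ Finset.range m, (if (x (s + 1)).2 then (1 : ℕ) else 0)) : ℕ) : ℝ) - a| ∂P := by
        congr 1
        refine integral_congr_ae (ae_of_all _ fun x => ?_)
        simp only [hwt]
        exact sum_sq_indicator_sub_indicator ((headCount_mono x hmN.le).trans (by
          have : (∑ s ∈ Finset.range N, (if (x (s + 1)).2 then (1 : ℕ) else 0)) ≤ N := by
            calc (∑ s ∈ Finset.range N, (if (x (s + 1)).2 then (1 : ℕ) else 0)) ≤ ∑ s ∈ Finset.range N, 1 :=
                Finset.sum_le_sum fun s _ => by split_ifs <;> norm_num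
              _ = N := by simp
          exact this)) haN

/-- **`E[D²] ≤ v (√m + |e m − a|)`.** -/
theorem splitChain_anscombe_sq_le {π : Measure Ω} [IsProbabilityMeasure π]
    (hπ : Kernel.Invariant κ π) (hε0 : 0 < ε) (hε : ε < 1)
    (hκs : ∀ p, κs p = (ε • ν).map (fun y : Ω => (y, true))
      + ((1 - ε) • Doeblin.residualKernel κ ν ε hmin p.1).map (fun y : Ω => (y, false)))
    {f : Ω → ℝ} (hf : Measurable f) {C : ℝ} (hC : ∀ x, |f x| ≤ C)
    {m a N : ℕ} (hmN : m < N) (haN : a ≤ N) :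
    ∫ x, (∑ i ∈ Finset.range N, ((if i + 1 ≤ (∑ s ∈ Finset.range m, (if (x (s + 1)).2 then (1 : ℕ) else 0)) then (1 : ℝ) else 0) - (if i + 1 ≤ a then (1 : ℝ) else 0)) * (∑' u, (if (∑ s ∈ Finset.range u, (if (x (s + 1)).2 then (1 : ℕ) else 0)) = i + 1 then (1 : ℝ) else 0) * (f (x u).1 - ∫ z, f z ∂π))) ^ 2 ∂(Kernel.trajMeasure (X := fun _ : ℕ => Ω × Bool) μs
        (fun n : ℕ => κs.comap (fun h : (i : ↥(Finset.Iic n)) → Ω × Bool =>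
          h ⟨n, Finset.mem_Iic.2 le_rfl⟩) (measurable_pi_apply _)))
      ≤ (∫ y, (∑' u, (if (∑ s ∈ Finset.range u, (if (y (s + 1)).2 then (1 : ℕ) else 0)) = 0 then (1 : ℝ) else 0) * (f (y u).1 - ∫ z, f z ∂π)) ^ 2 ∂(Kernel.trajMeasure (X := fun _ : ℕ => Ω × Bool) (ν.map (fun y : Ω => (y, true)))
        (fun n : ℕ => κs.comap (fun h : (i : ↥(Finset.Iic n)) → Ω × Bool =>
          h ⟨n, Finset.mem_Iic.2 le_rfl⟩) (measurable_pi_apply _))))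
        * (Real.sqrt m + |ε.toReal * m - a|) := by
  haveI hνt : IsProbabilityMeasure (ν.map (fun y : Ω => (y, true))) :=
    Measure.isProbabilityMeasure_map (measurable_tagCoin true).aemeasurable
  rw [(splitChain_anscombe_sq_eq κs μs (κ := κ) (ν := ν) (hmin := hmin) hπ hε0 hε hκs hf hC hmN haN).2]
  refine mul_le_mul_of_nonneg_left ?_ (integral_nonneg fun y => sq_nonneg _)
  set P := (Kernel.trajMeasure (X := fun _ : ℕ => Ω × Bool) μs
        (fun n : ℕ => κs.comap (fun h : (i : ↥(Finset.Iic n)) → Ω × Bool =>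
          h ⟨n, Finset.mem_Iic.2 le_rfl⟩) (measurable_pi_apply _))) with hP
  have hK : ∀ x : ℕ → Ω × Bool, (((∑ s ∈ Finset.range m, (if (x (s + 1)).2 then (1 : ℕ) else 0)) : ℕ) : ℝ)
      = ∑ s ∈ Finset.range m, (if (x (s + 1)).2 then (1 : ℝ) else 0) := fun x => by
    push_cast
    exact Finset.sum_congr rfl fun s _ => by split_ifs <;> simp
  have hDm : Measurable fun x : ℕ → Ω × Bool =>
      (∑ s ∈ Finset.range m, (if (x (s + 1)).2 then (1 : ℝ) else 0)) - ε.toReal * m :=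
    (Finset.measurable_sum _ fun s _ => measurable_coinHeads (s + 1)).sub_const _
  have hDI : Integrable (fun x : ℕ → Ω × Bool =>
      |(∑ s ∈ Finset.range m, (if (x (s + 1)).2 then (1 : ℝ) else 0)) - ε.toReal * m|) P := by
    refine integrable_of_bounded P hDm.abs (C := m + ε.toReal * m) fun x => ?_
    rw [abs_abs]
    refine (abs_sub _ _).trans (add_le_add ?_ (le_of_eq (abs_of_nonneg (by positivity))))
    refine (Finset.abs_sum_le_sum_abs _ _).trans ?_
    calc ∑ s ∈ Finset.range m, |(if (x (s + 1)).2 then (1 : ℝ) else 0)|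
        ≤ ∑ s ∈ Finset.range m, (1 : ℝ) := Finset.sum_le_sum fun s _ => by split_ifs <;> simp
      _ = m := by simp
  have hpt : ∀ x : ℕ → Ω × Bool, |(((∑ s ∈ Finset.range m, (if (x (s + 1)).2 then (1 : ℕ) else 0)) : ℕ) : ℝ) - a|
      ≤ |(∑ s ∈ Finset.range m, (if (x (s + 1)).2 then (1 : ℝ) else 0)) - ε.toReal * m|
        + |ε.toReal * m - a| := fun x => by
    rw [hK]
    exact abs_sub_le _ _ _
  calc ∫ x, |(((∑ s ∈ Finset.range m, (if (x (s + 1)).2 then (1 : ℕ) else 0)) : ℕ) : ℝ) - a| ∂P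
      ≤ ∫ x, (|(∑ s ∈ Finset.range m, (if (x (s + 1)).2 then (1 : ℝ) else 0)) - ε.toReal * m|
          + |ε.toReal * m - a|) ∂P := by
        refine integral_mono_of_nonneg (ae_of_all _ fun x => abs_nonneg _)
          (hDI.add (integrable_const _)) (ae_of_all _ hpt)
    _ = (∫ x, |(∑ s ∈ Finset.range m, (if (x (s + 1)).2 then (1 : ℝ) else 0)) - ε.toReal * m| ∂P)
          + |ε.toReal * m - a| := by
        rw [integral_add hDI (integrable_const _), integral_const, probReal_univ, one_smul]
    _ ≤ Real.sqrt m + |ε.toReal * m - a| := by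
        have h := splitChain_headCount_abs_dev_le κs μs (κ := κ) (ν := ν) (hmin := hmin) hε hκs m
        rw [← hP] at h
        linarith

end Anscombe

end Summit.Ventures.LatticeQCDFlow.Scoring

end
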